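import Summits.PneNP.PneNP.Theses.BavardGap
import Literature.Computability.Complexity.ClayProblemProofs
import Literature.GroupTheory.CombinatorialGroupTheory.RandomSclFreeGroupProofs

/-!
# Route BavardGap — `Assembly` (stmt-PneNP-10860)

`BavardGapUncertifiable → PgDecisionInNP → PneNP`. Contrapositive, as planned in the route file: `¬ PneNP` gives
`PNPWave0.NP Bool ⊆ PNPWave0.P Bool`, i.e. `NP ⊆ P` through the proved bridges `P_bool_eq_holds`, `NP_bool_eq_holds`;
with `PgDecisionInNP` the pairing-genus language `PG` is in `P`, so is `PGᶜ` (`compl_mem_P_iff`), and the machine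
deciding `PGᶜ` for the identity encoding (`mem_P_iff_holds`) witnesses `PolyTimeComputable enc encodeBool R` for
`R (w, t) := [enc (w, t) ∉ PG]`. `R` is sound, and `0`-tight at EVERY word (monotonicity of the genus bound in `t`
and injectivity of `enc = boolPair (2-bit letter code) (unary t)`), so the tight fraction is `1` on the (non-empty,
`commutatorWords_nonempty`) set of reduced balanced words of every length `2n ≥ 4` — never `< 1/2` for `n ≥ 2`.
-/

set_option linter.dupNamespace false -- `Summit.PneNP.PneNP.…`: summit = sub-problem name (D-0017 single-conjunct layout)

namespace Summit.PneNP.PneNP.Theorems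

open _root_.Computability Filter
open Literature.Computability.Complexity Literature.GroupTheory.CombinatorialGroupTheory

/-- The 2-bit letter code of words over `F₂` is injective. [folklore] -/
theorem bavardGap_letterCode_injective :
    Function.Injective fun l : List (Fin 2 × Bool) => l.flatMap fun a => [decide (a.1 = 1), a.2] := by
  intro l₁
  induction l₁ with
  | nil =>
    intro l₂ h
    cases l₂ with
    | nil => rfl
    | cons a l => simp at h
  | cons a l ih =>
    intro l₂ h
    cases l₂ with
    | nil => simp at h
    | cons b m =>
      simp only [List.flatMap_cons, List.cons_append, List.nil_append, List.cons.injEq] at h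
      obtain ⟨h1, h2, h3⟩ := h
      have hab : a = b := by
        refine Prod.ext (Fin.ext ?_) h2
        have ha := a.1.isLt
        have hb := b.1.isLt
        by_cases hA : a.1 = 1
        · have hB : b.1 = 1 := by simpa [hA] using h1
          rw [hA, hB]
        · have hB : ¬ b.1 = 1 := by simpa [hA] using h1
          have hA' : a.1.val ≠ 1 := fun h => hA (Fin.ext h)
          have hB' : b.1.val ≠ 1 := fun h => hB (Fin.ext h)
          omega
      rw [hab, ih h3]

/-- The instance code `enc (w, t) = boolPair (letter code of w) (unary t)` is injective. [folklore] -/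
theorem bavardGap_enc_injective :
    Function.Injective fun p : List (Fin 2 × Bool) × ℕ =>
      boolPair ((p.1).flatMap fun a => [decide (a.1 = 1), a.2]) (unaryEncodeNat p.2) := by
  rintro ⟨l₁, t₁⟩ ⟨l₂, t₂⟩ h
  have h' := congrArg boolUnpair h
  simp only [boolUnpair_boolPair, Prod.mk.injEq] at h'
  obtain ⟨hl, ht⟩ := h'
  have hl' := bavardGap_letterCode_injective hl
  have ht' : t₁ = t₂ := by rw [← unary_decode_encode_nat t₁, ht, unary_decode_encode_nat]
  simp only [hl', ht']

/-- From a `P`-decider of the complement of a language `S`: a polynomial-time Boolean function `R` on word/threshold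
pairs, for the route's instance encoding, with `R (w, t) = true ↔ enc (w, t) ∉ S` (the same machine; the time bound is
read at `|enc (w, t)|`). [cite: AroraBarak2009, Def. 1.13] [folklore] -/
theorem bavardGap_exists_refuter {S : Language Bool} (hS : Sᶜ ∈ Classes.P) :
    ∃ R : List (Fin 2 × Bool) × ℕ → Bool,
      PolyTimeComputable (fun p : List (Fin 2 × Bool) × ℕ =>
        boolPair ((p.1).flatMap fun a => [decide (a.1 = 1), a.2]) (unaryEncodeNat p.2)) encodeBool R ∧
      ∀ p, R p = true ↔ boolPair ((p.1).flatMap fun a => [decide (a.1 = 1), a.2]) (unaryEncodeNat p.2) ∉ S := by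
  obtain ⟨q, M, hM⟩ := mem_P_iff_holds.1 hS
  refine ⟨fun p => Sᶜ.boolIndicator (boolPair ((p.1).flatMap fun a => [decide (a.1 = 1), a.2]) (unaryEncodeNat p.2)),
    ⟨q, M, fun p => ?_⟩, fun p => (Set.mem_iff_boolIndicator _ _).symm⟩
  have h := hM (boolPair ((p.1).flatMap fun a => [decide (a.1 = 1), a.2]) (unaryEncodeNat p.2))
  exact h

/-- **Assembly of route BavardGap (stmt-PneNP-10860)**: `BavardGapUncertifiable → PgDecisionInNP → PneNP`.
Under `¬ PneNP` the exact genus refuter `R (w, t) = [enc (w, t) ∉ PG]` is polynomial-time, sound and `0`-tight at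
every word, so the `C`-tight fraction is `1 ≥ 1/2` for every `n ≥ 2`. [cite: Heuer2020, Cor. 2.5] [cite: CookClay2006, §1] -/
theorem bavardGap_assembly_proof : Summit.PneNP.PneNP.Theses.BavardGap.Assembly := by
  classical
  intro hX hPg
  by_contra hne
  have hall : ∀ L : Language Bool, L ∈ PNPWave0.NP Bool → L ∈ PNPWave0.P Bool := by
    intro L hL
    by_contra hLP
    exact hne ⟨L, hL, hLP⟩
  -- the genus language is in `P`, hence so is its complement
  have hNP := hPg
  unfold Summit.PneNP.PneNP.Theses.BavardGap.PgDecisionInNP at hNP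
  rw [← show PNPWave0.NP Bool = Nondeterministic.NP from NP_bool_eq_holds] at hNP
  have hP := hall _ hNP
  rw [show PNPWave0.P Bool = Classes.P from P_bool_eq_holds] at hP
  obtain ⟨R, hRpoly, hRiff⟩ := bavardGap_exists_refuter (compl_mem_P_iff.2 hP)
  obtain ⟨C, hC⟩ := hX
  have hsound := hC R hRpoly (fun l t hRt hex => (hRiff (l, t)).1 hRt ⟨l, t, rfl, hex⟩)
  obtain ⟨n, hlt, hn2⟩ := (hsound.and_eventually (eventually_ge_atTop 2)).exists
  revert hlt
  rw [imp_false, not_lt]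
  -- every reduced balanced word is `C`-tight for `R`
  rw [Finset.filter_true_of_mem]
  · have hne : (Finset.univ.filter fun w : Fin (2 * n) → Fin 2 × Bool =>
        FreeGroup.reduce (List.ofFn w) = List.ofFn w ∧
          ∀ a : Fin 2, (Finset.univ.filter fun i => w i = (a, true)).card =
            (Finset.univ.filter fun i => w i = (a, false)).card).Nonempty := by
      rw [← commutatorWords_eq_filter_balanced]
      exact commutatorWords_nonempty le_rfl (by omega) (even_two_mul n)
    have hpos : (0 : ℝ) < (Finset.univ.filter fun w : Fin (2 * n) → Fin 2 × Bool =>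
        FreeGroup.reduce (List.ofFn w) = List.ofFn w ∧
          ∀ a : Fin 2, (Finset.univ.filter fun i => w i = (a, true)).card =
            (Finset.univ.filter fun i => w i = (a, false)).card).card := by
      exact_mod_cast hne.card_pos
    rw [div_self hpos.ne']
    norm_num
  · intro w _ t hnot
    refine (hRiff (List.ofFn w, t)).2 ?_
    rintro ⟨l', t', heq, π, hπ1, hπ2, hπ3, hπ4⟩
    obtain ⟨rfl, rfl⟩ := Prod.mk.inj (bavardGap_enc_injective heq.symm)
    exact hnot ⟨π, hπ1, hπ2, hπ3, by omega⟩

end Summit.PneNP.PneNP.Theorems
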